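import Summits.QuantumFields.YangMills.Theorems.FemtoTransferGapBlockToFine
import Summits.QuantumFields.YangMills.Theorems.FemtoTransferGapSpectralSumsRootCross
import Summits.QuantumFields.YangMills.Theorems.FemtoTransferGapLevelsDecay
import HarnessLib

/-!
# Femto transfer gap — ★★ the CROSS block-to-fine door for two once-block-dressed physical vectors
# (crux idea «block-endpoint» on crux `DressedRitz`, stmt-QuantumFields-20205; LEAD prover ym-lead-20205-polyakovlift g4)

Companion of `FemtoTransferGapBlockToFine` (single-vector door (a)(b)(c)).  For two physical `v, w`, `β > 0`, block length `ℓ ≥ 1`, `u = K^ℓ v`, `u' = K^ℓ w`,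
the FINE symmetrised coupling of the pair — the quantity of clause (o6)/(A6′) of line «polyakovlift» —

  `c = ⟨u, K u'⟩ − m̄·⟨u, u'⟩`,  `m̄ = (⟨u,Ku⟩/‖u‖² + ⟨u',Ku'⟩/‖u'‖²)/2`,

equals `(m̄/(ℓX₀))·(⟨u, K^ℓ u'⟩ − X₀⟨u,u'⟩)` (`X₀ = m̄^ℓ`; a BLOCK-aligned cross datum at times `2ℓ, 3ℓ`) up to
`(m̄/(2ℓ))·(τ‖u‖²Φ + ‖u'‖²Φ'/τ)`, `Φ = (32Θ⁴+8Θ)δ + 32Θ²(X̄/X₀ − 1)²`, where `δ` bounds the raw and dressed block defects of both vectors, `X̄ = ⟨u,K^ℓu⟩/‖u‖²`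
is the block Rayleigh quotient, and `Θ` bounds `X̄/X₀`, `X₀/X̄` and `λ₀^ℓ/X₀`:

* `exists_cross_data` — joint spectral sums of two physical vectors on ONE eigen-sequence;  ★★ `cross_door`.

So the `λ²/L` precision of (o6)/(A6′) follows from block cross data at `L`-FREE precision `λ²` plus block defects `O(λ³)` plus the (automatic, `O(λ²)`) mismatch of
the two channels' block quotients (pure real engine: `SpecSum.cross_door`, `FemtoTransferGapSpectralSumsRootCross`).

HONEST FRAMING: fixed-lattice transfer-operator algebra (any `L`, `β > 0`), infrastructure for the CONDITIONAL femto rung R2b1; it closes no stub by itself and bears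
on neither infinite volume, nor the continuum limit, nor the Clay gap.  References: Reed–Simon IV, Thm. XIII.1 [cite: ReedSimonIV1978, Thm. XIII.1];
M. Lüscher, U. Wolff, NPB 339 (1990) 222 [cite: LuscherWolff1990].
-/

set_option autoImplicit false

noncomputable section

open MeasureTheory Filter Topology Real
open scoped BigOperators
open Literature.MathematicalPhysics.QuantumFieldTheory
open Literature.MathematicalPhysics.QuantumLattice

namespace Summit.QuantumFields.YangMills.Theorems.FemtoTransferGap

namespace BlockToFine

variable {L : ℕ} [NeZero L]

/-! ## §1 Joint spectral data of two physical vectors -/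

/-- Joint spectral sums of two physical vectors `v, w` on ONE eigen-sequence (`λ_k = levelValue k`, `a_k = ⟨v,e_k⟩`, `b_k = ⟨w,e_k⟩`): the single-vector sums of
`exists_root_data` for both, the cross sums `⟨K^ℓ v, K^{ℓ+p} w⟩`, `p ∈ {0, 1, ℓ}`, Bessel, and `λ_k ≤ λ_0`. [cite: ReedSimonIV1978, Thm. XIII.1] -/
theorem exists_cross_data {β : ℝ} (hβ : 0 < β) {v w : GaugeConfig 3 L SU2 → ℝ} (hv : IsPhys v) (hw : IsPhys w) {ℓ : ℕ} (hℓ : 1 ≤ ℓ) :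
    ∃ (lam a b : ℕ → ℝ) (Aa Ab : ℝ), (∀ k, 0 ≤ lam k) ∧ (∀ k, lam k ≤ levelValue su2Rep L β 0) ∧
      HasSum (fun k => a k ^ 2) Aa ∧ Aa ≤ l2 v v ∧
      HasSum (fun k => lam k ^ ℓ * a k ^ 2) (l2 v ((transferApply β)^[ℓ] v)) ∧
      HasSum (fun k => lam k ^ (2 * ℓ) * a k ^ 2) (l2 ((transferApply β)^[ℓ] v) ((transferApply β)^[ℓ] v)) ∧
      HasSum (fun k => lam k ^ (2 * ℓ + 1) * a k ^ 2) (l2 ((transferApply β)^[ℓ] v) ((transferApply β)^[ℓ + 1] v)) ∧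
      HasSum (fun k => lam k ^ (3 * ℓ) * a k ^ 2) (l2 ((transferApply β)^[ℓ] v) ((transferApply β)^[2 * ℓ] v)) ∧
      HasSum (fun k => lam k ^ (4 * ℓ) * a k ^ 2) (l2 ((transferApply β)^[ℓ] v) ((transferApply β)^[3 * ℓ] v)) ∧
      HasSum (fun k => b k ^ 2) Ab ∧ Ab ≤ l2 w w ∧
      HasSum (fun k => lam k ^ ℓ * b k ^ 2) (l2 w ((transferApply β)^[ℓ] w)) ∧
      HasSum (fun k => lam k ^ (2 * ℓ) * b k ^ 2) (l2 ((transferApply β)^[ℓ] w) ((transferApply β)^[ℓ] w)) ∧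
      HasSum (fun k => lam k ^ (2 * ℓ + 1) * b k ^ 2) (l2 ((transferApply β)^[ℓ] w) ((transferApply β)^[ℓ + 1] w)) ∧
      HasSum (fun k => lam k ^ (3 * ℓ) * b k ^ 2) (l2 ((transferApply β)^[ℓ] w) ((transferApply β)^[2 * ℓ] w)) ∧
      HasSum (fun k => lam k ^ (4 * ℓ) * b k ^ 2) (l2 ((transferApply β)^[ℓ] w) ((transferApply β)^[3 * ℓ] w)) ∧
      HasSum (fun k => lam k ^ (2 * ℓ) * (a k * b k)) (l2 ((transferApply β)^[ℓ] v) ((transferApply β)^[ℓ] w)) ∧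
      HasSum (fun k => lam k ^ (2 * ℓ + 1) * (a k * b k)) (l2 ((transferApply β)^[ℓ] v) ((transferApply β)^[ℓ + 1] w)) ∧
      HasSum (fun k => lam k ^ (3 * ℓ) * (a k * b k)) (l2 ((transferApply β)^[ℓ] v) ((transferApply β)^[2 * ℓ] w)) := by
  obtain ⟨e, -, -, -, hsum, hbessel⟩ := SpecSum.exists_spectral_eigenseq (L := L) hβ
  set lam : ℕ → ℝ := fun k => levelValue su2Rep L β k with hlam
  set a : ℕ → ℝ := fun k => l2 v ((e k : physSubmodule L) : GaugeConfig 3 L SU2 → ℝ) with ha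
  set b : ℕ → ℝ := fun k => l2 w ((e k : physSubmodule L) : GaugeConfig 3 L SU2 → ℝ) with hb
  obtain ⟨hsA, hAle⟩ := hbessel v hv
  obtain ⟨hsB, hBle⟩ := hbessel w hw
  have hSv : ∀ m n : ℕ, 1 ≤ m + n → ∀ p : ℕ, p = m + n →
      HasSum (fun k => lam k ^ p * a k ^ 2) (l2 ((transferApply β)^[m] v) ((transferApply β)^[n] v)) := by
    intro m n hmn p hp
    refine (hsum v v hv hv m n hmn).congr_fun fun k => ?_
    rw [hp, sq]; ring
  have hSw : ∀ m n : ℕ, 1 ≤ m + n → ∀ p : ℕ, p = m + n →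
      HasSum (fun k => lam k ^ p * b k ^ 2) (l2 ((transferApply β)^[m] w) ((transferApply β)^[n] w)) := by
    intro m n hmn p hp
    refine (hsum w w hw hw m n hmn).congr_fun fun k => ?_
    rw [hp, sq]; ring
  have hSx : ∀ m n : ℕ, 1 ≤ m + n → ∀ p : ℕ, p = m + n →
      HasSum (fun k => lam k ^ p * (a k * b k)) (l2 ((transferApply β)^[m] v) ((transferApply β)^[n] w)) := by
    intro m n hmn p hp
    refine (hsum w v hw hv m n hmn).congr_fun fun k => ?_
    rw [hp]; ring
  have h0v : (transferApply β)^[0] v = v := rfl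
  have h0w : (transferApply β)^[0] w = w := rfl
  refine ⟨lam, a, b, _, _, fun k => levelValue_su2Rep_nonneg L hβ.le k, fun k => levelValue_le_of_le hβ (Nat.zero_le k),
    hsA.hasSum, hAle, ?_, ?_, ?_, ?_, ?_, hsB.hasSum, hBle, ?_, ?_, ?_, ?_, ?_, ?_, ?_, ?_⟩
  · have := hSv 0 ℓ (by omega) ℓ (by omega); rwa [h0v] at this
  · exact hSv ℓ ℓ (by omega) (2 * ℓ) (by omega)
  · exact hSv ℓ (ℓ + 1) (by omega) (2 * ℓ + 1) (by omega)
  · exact hSv ℓ (2 * ℓ) (by omega) (3 * ℓ) (by omega)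
  · exact hSv ℓ (3 * ℓ) (by omega) (4 * ℓ) (by omega)
  · have := hSw 0 ℓ (by omega) ℓ (by omega); rwa [h0w] at this
  · exact hSw ℓ ℓ (by omega) (2 * ℓ) (by omega)
  · exact hSw ℓ (ℓ + 1) (by omega) (2 * ℓ + 1) (by omega)
  · exact hSw ℓ (2 * ℓ) (by omega) (3 * ℓ) (by omega)
  · exact hSw ℓ (3 * ℓ) (by omega) (4 * ℓ) (by omega)
  · exact hSx ℓ ℓ (by omega) (2 * ℓ) (by omega)
  · exact hSx ℓ (ℓ + 1) (by omega) (2 * ℓ + 1) (by omega)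
  · exact hSx ℓ (2 * ℓ) (by omega) (3 * ℓ) (by omega)

/-! ## §2 ★★ The cross door -/

/-- ★★ **CROSS DOOR** for `u = K^ℓ v`, `u' = K^ℓ w` (`v, w` physical, `β > 0`, `ℓ ≥ 1`): if the raw and dressed block defects of both are `≤ δ ≤ 1/32`, the block
Rayleigh quotients `X̄ = ⟨u,K^ℓu⟩/‖u‖²`, `X̄'` lie in `[X₀/Θ, ΘX₀]` and `λ₀^ℓ ≤ ΘX₀` (`X₀ = m̄^ℓ`, `m̄` the mean fine Rayleigh quotient), then for every `τ > 0`
`|⟨u,Ku'⟩ − m̄⟨u,u'⟩ − (m̄/(ℓX₀))(⟨u,K^ℓu'⟩ − X₀⟨u,u'⟩)| ≤ (m̄/(2ℓ))·(τ‖u‖²Φ + ‖u'‖²Φ'/τ)`, `Φ = (32Θ⁴+8Θ)δ + 32Θ²(X̄/X₀ − 1)²`.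
[cite: ReedSimonIV1978, Thm. XIII.1] [cite: LuscherWolff1990] -/
theorem cross_door {β : ℝ} (hβ : 0 < β) {v w : GaugeConfig 3 L SU2 → ℝ} (hv : IsPhys v) (hw : IsPhys w) {ℓ : ℕ} (hℓ : 1 ≤ ℓ)
    {δ Θ τ : ℝ} (hδ0 : 0 ≤ δ) (hδ : δ ≤ 1 / 32) (hΘ : 1 ≤ Θ) (hτ : 0 < τ)
    (hposv : 0 < l2 ((transferApply β)^[ℓ] v) ((transferApply β)^[ℓ] v))
    (hposw : 0 < l2 ((transferApply β)^[ℓ] w) ((transferApply β)^[ℓ] w))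
    (hrawv : l2 v ((transferApply β)^[2 * ℓ] v) * l2 v v ≤ (1 + δ) * l2 v ((transferApply β)^[ℓ] v) ^ 2)
    (hdressv : l2 ((transferApply β)^[ℓ] v) ((transferApply β)^[3 * ℓ] v) * l2 ((transferApply β)^[ℓ] v) ((transferApply β)^[ℓ] v) ≤
      (1 + δ) * l2 ((transferApply β)^[ℓ] v) ((transferApply β)^[2 * ℓ] v) ^ 2)
    (hraww : l2 w ((transferApply β)^[2 * ℓ] w) * l2 w w ≤ (1 + δ) * l2 w ((transferApply β)^[ℓ] w) ^ 2)
    (hdressw : l2 ((transferApply β)^[ℓ] w) ((transferApply β)^[3 * ℓ] w) * l2 ((transferApply β)^[ℓ] w) ((transferApply β)^[ℓ] w) ≤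
      (1 + δ) * l2 ((transferApply β)^[ℓ] w) ((transferApply β)^[2 * ℓ] w) ^ 2)
    (hX1 : l2 ((transferApply β)^[ℓ] v) ((transferApply β)^[2 * ℓ] v) / l2 ((transferApply β)^[ℓ] v) ((transferApply β)^[ℓ] v) ≤
      Θ * ((l2 ((transferApply β)^[ℓ] v) ((transferApply β)^[ℓ + 1] v) / l2 ((transferApply β)^[ℓ] v) ((transferApply β)^[ℓ] v) +
        l2 ((transferApply β)^[ℓ] w) ((transferApply β)^[ℓ + 1] w) / l2 ((transferApply β)^[ℓ] w) ((transferApply β)^[ℓ] w)) / 2) ^ ℓ)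
    (hX2 : ((l2 ((transferApply β)^[ℓ] v) ((transferApply β)^[ℓ + 1] v) / l2 ((transferApply β)^[ℓ] v) ((transferApply β)^[ℓ] v) +
        l2 ((transferApply β)^[ℓ] w) ((transferApply β)^[ℓ + 1] w) / l2 ((transferApply β)^[ℓ] w) ((transferApply β)^[ℓ] w)) / 2) ^ ℓ ≤
      Θ * (l2 ((transferApply β)^[ℓ] v) ((transferApply β)^[2 * ℓ] v) / l2 ((transferApply β)^[ℓ] v) ((transferApply β)^[ℓ] v)))
    (hX1' : l2 ((transferApply β)^[ℓ] w) ((transferApply β)^[2 * ℓ] w) / l2 ((transferApply β)^[ℓ] w) ((transferApply β)^[ℓ] w) ≤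
      Θ * ((l2 ((transferApply β)^[ℓ] v) ((transferApply β)^[ℓ + 1] v) / l2 ((transferApply β)^[ℓ] v) ((transferApply β)^[ℓ] v) +
        l2 ((transferApply β)^[ℓ] w) ((transferApply β)^[ℓ + 1] w) / l2 ((transferApply β)^[ℓ] w) ((transferApply β)^[ℓ] w)) / 2) ^ ℓ)
    (hX2' : ((l2 ((transferApply β)^[ℓ] v) ((transferApply β)^[ℓ + 1] v) / l2 ((transferApply β)^[ℓ] v) ((transferApply β)^[ℓ] v) +
        l2 ((transferApply β)^[ℓ] w) ((transferApply β)^[ℓ + 1] w) / l2 ((transferApply β)^[ℓ] w) ((transferApply β)^[ℓ] w)) / 2) ^ ℓ ≤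
      Θ * (l2 ((transferApply β)^[ℓ] w) ((transferApply β)^[2 * ℓ] w) / l2 ((transferApply β)^[ℓ] w) ((transferApply β)^[ℓ] w)))
    (htop : levelValue su2Rep L β 0 ^ ℓ ≤
      Θ * ((l2 ((transferApply β)^[ℓ] v) ((transferApply β)^[ℓ + 1] v) / l2 ((transferApply β)^[ℓ] v) ((transferApply β)^[ℓ] v) +
        l2 ((transferApply β)^[ℓ] w) ((transferApply β)^[ℓ + 1] w) / l2 ((transferApply β)^[ℓ] w) ((transferApply β)^[ℓ] w)) / 2) ^ ℓ) :
    let n := l2 ((transferApply β)^[ℓ] v) ((transferApply β)^[ℓ] v)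
    let n' := l2 ((transferApply β)^[ℓ] w) ((transferApply β)^[ℓ] w)
    let mb := (l2 ((transferApply β)^[ℓ] v) ((transferApply β)^[ℓ + 1] v) / n + l2 ((transferApply β)^[ℓ] w) ((transferApply β)^[ℓ + 1] w) / n') / 2
    let X0 := mb ^ ℓ
    |l2 ((transferApply β)^[ℓ] v) ((transferApply β)^[ℓ + 1] w) - mb * l2 ((transferApply β)^[ℓ] v) ((transferApply β)^[ℓ] w) -
        mb / (ℓ * X0) * (l2 ((transferApply β)^[ℓ] v) ((transferApply β)^[2 * ℓ] w) - X0 * l2 ((transferApply β)^[ℓ] v) ((transferApply β)^[ℓ] w))| ≤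
      mb / (2 * ℓ) *
        (τ * n * ((32 * Θ ^ 4 + 8 * Θ) * δ + 32 * Θ ^ 2 * (l2 ((transferApply β)^[ℓ] v) ((transferApply β)^[2 * ℓ] v) / n / X0 - 1) ^ 2) +
          n' * ((32 * Θ ^ 4 + 8 * Θ) * δ + 32 * Θ ^ 2 * (l2 ((transferApply β)^[ℓ] w) ((transferApply β)^[2 * ℓ] w) / n' / X0 - 1) ^ 2) / τ) := by
  intro n n' mb X0
  obtain ⟨lam, a, b, Aa, Ab, hnn, hle0, hAa, hAale, hRa, hNa, hDa, hTa, hQa, hAb, hAble, hRb, hNb, hDb, hTb, hQb, hNab, hDab, hTab⟩ :=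
    exists_cross_data hβ hv hw hℓ
  have hrawv' : l2 ((transferApply β)^[ℓ] v) ((transferApply β)^[ℓ] v) * l2 v v ≤ (1 + δ) * l2 v ((transferApply β)^[ℓ] v) ^ 2 := by
    rw [l2_iterate_iterate β hv, show ℓ + ℓ = 2 * ℓ by ring]; exact hrawv
  have hraww' : l2 ((transferApply β)^[ℓ] w) ((transferApply β)^[ℓ] w) * l2 w w ≤ (1 + δ) * l2 w ((transferApply β)^[ℓ] w) ^ 2 := by
    rw [l2_iterate_iterate β hw, show ℓ + ℓ = 2 * ℓ by ring]; exact hraww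
  have htop' : ∀ k, lam k ^ ℓ ≤ Θ * mb ^ ℓ := fun k =>
    le_trans (pow_le_pow_left₀ (hnn k) (hle0 k) ℓ) htop
  exact SpecSum.cross_door hnn hℓ hAa hRa hNa hDa hTa hQa hAb hRb hNb hDb hTb hQb hNab hDab hTab hposv hposw hAale hAble hδ0 hδ
    hrawv' hdressv hraww' hdressw hΘ hX1 hX2 hX1' hX2' htop' hτ

end BlockToFine

end Summit.QuantumFields.YangMills.Theorems.FemtoTransferGap

end
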